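import Mathlib.Algebra.Module.Projective
import Mathlib.LinearAlgebra.Isomorphisms
import Mathlib.RingTheory.Flat.Basic
import Mathlib.RingTheory.Flat.TorsionFree
import Mathlib.RingTheory.TensorProduct.Basic
import Literature.RingTheory.CohomologyAnnihilator.StableAnnihilation
import Literature.RingTheory.Localization.BirationalLinearMaps
import HarnessLib

/-!
# Birational transfer of stable annihilation

Topic: `Literature/RingTheory/CohomologyAnnihilator`.

Folklore homological algebra (the "birational stable-annihilation transfer"), serving the
persistence of cohomology annihilators along birational ring extensions. Throughout, `B → C` is a
map of commutative rings (`[Algebra B C]`), and a *stable factorisation of `c`* on a module `Y` is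
a pair of linear maps `Y —ι→ P —π→ Y` with `π ∘ ι = c • id`; when `P` is projective this forces
`c • Extⁱ(Y, N) = 0` for all `N` and all `i ≥ 1` (`smul_ext_eq_zero_of_comp_eq_smul_id` in the
sibling file `StableAnnihilation`).

1. **Base change** (`baseChange_comp_baseChange_eq_smul_id`): a `B`-linear stable factorisation
   `π₀ ∘ ι₀ = c • id` of `c : B` on `Y₀` through `P₀` base-changes to the `C`-linear stable
   factorisation `π₀.baseChange C ∘ ι₀.baseChange C = (algebraMap B C c) • id` of `C ⊗[B] Y₀`
   through `C ⊗[B] P₀` — which is `C`-projective when `P₀` is `B`-projective (Mathlib's instance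
   `Module.Projective.tensorProduct`), and then torsion-free over `B` as soon as `C` is
   (`isTorsionFree_baseChange`).
2. **Quotients** (`mkQ_comp_comp_liftQ_eq_smul_id`, `exists_comp_eq_smul_id_of_surjective`): a
   stable factorisation of `c` on `M` through `P` descends to `M ⧸ T` for every submodule
   `T ≤ ker ι`, and more generally along every surjection `Φ : M → Y` with `ker Φ ≤ ker ι`.
3. **Conclusion in `ModuleCat C`** (`smul_ext_eq_zero_of_linearMap_comp_eq_smul_id`,
   `smul_ext_eq_zero_of_surjective`, **`smul_ext_eq_zero_of_baseChange`**,
   `smul_ext_quotient_eq_zero_of_baseChange`): packaging 1 + 2 with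
   `smul_ext_eq_zero_of_comp_eq_smul_id`: if `c • id_{Y₀}` factors `B`-linearly through a
   projective `B`-module `P₀` and the `C`-module `Y` receives a surjection from `C ⊗[B] Y₀` whose
   kernel is killed by `ι₀.baseChange C` (e.g. `Y = (C ⊗[B] Y₀) ⧸ T`, `T ≤ ker (ι₀.baseChange C)`),
   then `algebraMap B C c` kills `Extⁱ_C(Y, N)` for every `C`-module `N` and every `i ≥ 1`.
   `ModuleCat.comp_eq_smul_id_iff` translates between `f ≫ g = c • 𝟙 X` in `ModuleCat B` (the
   output of the splitting criterion `exists_comp_eq_smul_id_of_smul_extClass_eq_zero` of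
   `StableAnnihilation`) and `g.hom ∘ₗ f.hom = c • LinearMap.id` (the input here).
4. **The birational instance** (**`smul_ext_eq_zero_of_isBirational`**): let `B → C` be
   *birational* in the weak sense of `Literature.RingTheory.Localization.BirationalLinearMaps`
   (every `s : C` has `b · s = r · 1` for some non-zero-divisor `b ∈ B⁰` and some `r : B`) with `C`
   torsion-free over `B` (e.g. `B ⊆ C ⊆ Frac B`), and let `Y` be a `C`-module generated over `C` by
   the image of an injective `B`-linear map `φ : Y₀ → Y` (so `Y = C · Y₀`; no torsion-freeness of
   `Y` is needed). The multiplication map `Φ = φ.liftBaseChange C : C ⊗[B] Y₀ → Y`,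
   `s ⊗ y ↦ s • φ y`, is surjective (`liftBaseChange_surjective_of_span_eq_top`) and its kernel is
   `B⁰`-torsion: every `z : C ⊗[B] Y₀` has `b • z = 1 ⊗ y` for some `b ∈ B⁰`, `y : Y₀` (clear
   denominators, `exists_nonZeroDivisors_smul_eq_one_tmul`), and if `Φ z = 0` then
   `φ y = Φ (b • z) = 0`, so `y = 0` and `b • z = 0`
   (`exists_nonZeroDivisors_smul_eq_zero_of_liftBaseChange_eq_zero`); hence `ker Φ` lies in the
   kernel of every `C`-linear map to a `B`-torsion-free module (`ker_liftBaseChange_le_ker`), in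
   particular of `ι₀.baseChange C : C ⊗[B] Y₀ → C ⊗[B] P₀`. So 3 applies: a `B`-linear stable
   factorisation of `c` on `Y₀` through a projective `B`-module makes `algebraMap B C c` kill
   `Extⁱ_C(Y, N)` for all `C`-modules `N` and all `i ≥ 1`.
   `Subalgebra.smul_ext_eq_zero_of_span_eq` / `Subalgebra.smul_ext_eq_zero_of_le_of_span_eq` are
   the case of two subalgebras `B ≤ C` of a field `K` with `C ⊆ Frac B` inside `K`
   (`∀ s ∈ C, ∃ b ∈ B, b ≠ 0 ∧ b * s ∈ B`), `Y₀` a `↥B`-submodule of a `K`-vector space `V` and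
   `Y = C · Y₀` the `↥C`-submodule of `V` it spans (`Subalgebra.isTorsionFree_of_isScalarTower`:
   `↥C` is torsion-free over `↥B`).

Typical use (persistence of cohomology annihilators under a birational extension `B ⊆ C`): if
`c ∈ caⁿ⁺¹(B)` then `c • 𝟙` factors through a projective on every `n`-th syzygy module `Y₀` of a
finitely generated `B`-module (dimension shifting + splitting criterion, `StableAnnihilation`);
by 4, `c` then kills `Ext^{≥1}_C(Y, −)` for every `C`-module `Y = C · Y₀` with `Y₀ ↪ Y`.

Conventions: `Ext` statements live in `ModuleCat.{u} C` for `C : Type u` and modules in `Type u`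
(as in `CohomologyAnnihilator.Basic`); the two tensor-free ones allow `ModuleCat.{v} C` with
`[Small.{v} C]`. The birationality hypothesis `hbir` comes AFTER the linear-map data
(`ι₀ π₀ h`, resp. `φ hφ`) so that `B`, `C` are determined before it is elaborated (unifying
coerced subalgebras `↥B`, `↥C` out of `hbir` first is prohibitively slow). Deliberately NOT here:
the descended maps `Y → C ⊗[B] P₀ → Y` as bundled `def`s (only `∃` statements and the `Ext`
consequences), and any finiteness / noetherian hypotheses (none are needed).
-/

noncomputable section

open CategoryTheory CategoryTheory.Abelian TensorProduct

open scoped nonZeroDivisors TensorProduct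

universe v u

namespace Literature.RingTheory.CohomologyAnnihilator

/-! ## (1) Base change of a stable factorisation -/

/-- **Base change of a stable factorisation.** If `B`-linear maps `Y₀ —ι₀→ P₀ —π₀→ Y₀` satisfy
`π₀ ∘ ι₀ = c • id` for some `c : B`, then for every commutative `B`-algebra `C` the base-changed
`C`-linear maps `C ⊗[B] Y₀ → C ⊗[B] P₀ → C ⊗[B] Y₀` satisfy
`π₀.baseChange C ∘ ι₀.baseChange C = (algebraMap B C c) • id` (functoriality of `C ⊗[B] −`).
[folklore] -/
theorem baseChange_comp_baseChange_eq_smul_id {B C : Type*} [CommRing B] [CommRing C]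
    [Algebra B C] {Y₀ P₀ : Type*} [AddCommGroup Y₀] [Module B Y₀] [AddCommGroup P₀] [Module B P₀]
    (ι₀ : Y₀ →ₗ[B] P₀) (π₀ : P₀ →ₗ[B] Y₀) {c : B} (h : π₀ ∘ₗ ι₀ = c • LinearMap.id) :
    π₀.baseChange C ∘ₗ ι₀.baseChange C = algebraMap B C c • LinearMap.id := by
  rw [← LinearMap.baseChange_comp, h, LinearMap.baseChange_smul, LinearMap.baseChange_id,
    algebraMap_smul]

/-- The base change `C ⊗[B] P₀` of a projective `B`-module `P₀` to a commutative `B`-algebra `C`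
which is torsion-free over `B` is again torsion-free over `B`: it is `C`-projective
(`Module.Projective.tensorProduct`), hence `C`-flat, hence torsion-free over `C`
(`Module.Flat.isTorsionFree`), and regular elements of `B` stay regular on `C`
(`Module.IsTorsionFree.trans`). [folklore] -/
theorem isTorsionFree_baseChange (B C : Type*) [CommRing B] [CommRing C] [Algebra B C]
    [Module.IsTorsionFree B C] (P₀ : Type*) [AddCommGroup P₀] [Module B P₀]
    [Module.Projective B P₀] : Module.IsTorsionFree B (C ⊗[B] P₀) :=
  Module.IsTorsionFree.trans C

/-! ## (2) Passing to a quotient killed by `ι` -/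

/-- **Stable factorisations descend to quotients by submodules killed by `ι`.** If `C`-linear maps
`M —ι→ P —π→ M` satisfy `π ∘ ι = c • id` and `T ≤ ker ι` is a submodule, then the induced maps
`M ⧸ T —ῑ→ P —π̄→ M ⧸ T` (`ῑ = T.liftQ ι`, `π̄ = T.mkQ ∘ π`) again satisfy `π̄ ∘ ῑ = c • id`.
[folklore] -/
theorem mkQ_comp_comp_liftQ_eq_smul_id {C : Type*} [CommRing C] {M P : Type*} [AddCommGroup M]
    [Module C M] [AddCommGroup P] [Module C P] (ι : M →ₗ[C] P) (π : P →ₗ[C] M) {c : C}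
    (h : π ∘ₗ ι = c • LinearMap.id) (T : Submodule C M) (hT : T ≤ LinearMap.ker ι) :
    (T.mkQ ∘ₗ π) ∘ₗ T.liftQ ι hT = c • LinearMap.id := by
  refine Submodule.linearMap_qext _ (LinearMap.ext fun x => ?_)
  have hx : π (ι x) = c • x := LinearMap.congr_fun h x
  simp [hx]

/-- **Stable factorisations descend along surjections whose kernel is killed by `ι`.** If
`C`-linear maps `M —ι→ P —π→ M` satisfy `π ∘ ι = c • id` and `Φ : M → Y` is a surjective `C`-linear
map with `ker Φ ≤ ker ι`, then `c • id_Y` factors through `P`: there are `ι' : Y → P` (the map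
induced by `ι` on `Y ≅ M ⧸ ker Φ`) and `π' = Φ ∘ π : P → Y` with `π' ∘ ι' = c • id`. [folklore] -/
theorem exists_comp_eq_smul_id_of_surjective {C : Type*} [CommRing C] {M P Y : Type*}
    [AddCommGroup M] [Module C M] [AddCommGroup P] [Module C P] [AddCommGroup Y] [Module C Y]
    (ι : M →ₗ[C] P) (π : P →ₗ[C] M) {c : C} (h : π ∘ₗ ι = c • LinearMap.id)
    (Φ : M →ₗ[C] Y) (hΦ : Function.Surjective Φ) (hker : LinearMap.ker Φ ≤ LinearMap.ker ι) :
    ∃ (ι' : Y →ₗ[C] P) (π' : P →ₗ[C] Y), π' ∘ₗ ι' = c • LinearMap.id := by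
  refine ⟨(LinearMap.ker Φ).liftQ ι hker ∘ₗ (Φ.quotKerEquivOfSurjective hΦ).symm.toLinearMap,
    Φ ∘ₗ π, LinearMap.ext fun y => ?_⟩
  obtain ⟨x, rfl⟩ := hΦ y
  have hx : π (ι x) = c • x := LinearMap.congr_fun h x
  simp [hx]

/-! ## (3) Conclusion in `ModuleCat C` -/

/-- In `ModuleCat R` (`R` commutative), `f ≫ g = c • 𝟙 X` for `f : X ⟶ P`, `g : P ⟶ X` says
exactly that the underlying linear maps satisfy `g.hom ∘ₗ f.hom = c • LinearMap.id` (translation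
between the categorical stable factorisations of `StableAnnihilation` and the linear-map ones of
this file). [folklore] -/
theorem ModuleCat.comp_eq_smul_id_iff {R : Type u} [CommRing R] {X P : ModuleCat.{v} R}
    (f : X ⟶ P) (g : P ⟶ X) (c : R) :
    f ≫ g = c • 𝟙 X ↔ g.hom ∘ₗ f.hom = c • LinearMap.id := by
  rw [ModuleCat.hom_ext_iff, ModuleCat.hom_comp]
  exact Iff.rfl

/-- **Stable annihilation kills positive `Ext`, linear-map form.** If `C`-linear maps
`Y —ι→ P —π→ Y` with `P` a projective `C`-module satisfy `π ∘ ι = c • id`, then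
`c • Extⁱ_C(Y, N) = 0` for every `C`-module `N` and every `i ≥ 1` (the objects being
`ModuleCat.of C Y` and `N : ModuleCat C`; this is `smul_ext_eq_zero_of_comp_eq_smul_id` of
`StableAnnihilation` applied to `ModuleCat.ofHom ι`, `ModuleCat.ofHom π`). [folklore] -/
theorem smul_ext_eq_zero_of_linearMap_comp_eq_smul_id {C : Type u} [CommRing C] [Small.{v} C]
    {Y P : Type v} [AddCommGroup Y] [Module C Y] [AddCommGroup P] [Module C P]
    [Module.Projective C P] (ι : Y →ₗ[C] P) (π : P →ₗ[C] Y) {c : C}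
    (h : π ∘ₗ ι = c • LinearMap.id) (N : ModuleCat.{v} C) {i : ℕ} (hi : 1 ≤ i)
    (e : Ext.{v} (ModuleCat.of C Y) N i) : c • e = 0 :=
  smul_ext_eq_zero_of_comp_eq_smul_id (ModuleCat.ofHom ι) (ModuleCat.ofHom π)
    ((ModuleCat.comp_eq_smul_id_iff _ _ c).mpr h) hi e

/-- **Stable annihilation descends along surjections with `ι`-negligible kernel.** If `C`-linear
maps `M —ι→ P —π→ M` with `P` projective satisfy `π ∘ ι = c • id`, and `Φ : M → Y` is a
surjective `C`-linear map with `ker Φ ≤ ker ι`, then `c • Extⁱ_C(Y, N) = 0` for every `C`-module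
`N` and every `i ≥ 1` (`exists_comp_eq_smul_id_of_surjective` +
`smul_ext_eq_zero_of_linearMap_comp_eq_smul_id`). [folklore] -/
theorem smul_ext_eq_zero_of_surjective {C : Type u} [CommRing C] [Small.{v} C] {M P Y : Type v}
    [AddCommGroup M] [Module C M] [AddCommGroup P] [Module C P] [Module.Projective C P]
    [AddCommGroup Y] [Module C Y]
    (ι : M →ₗ[C] P) (π : P →ₗ[C] M) {c : C} (h : π ∘ₗ ι = c • LinearMap.id)
    (Φ : M →ₗ[C] Y) (hΦ : Function.Surjective Φ) (hker : LinearMap.ker Φ ≤ LinearMap.ker ι)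
    (N : ModuleCat.{v} C) {i : ℕ} (hi : 1 ≤ i) (e : Ext.{v} (ModuleCat.of C Y) N i) :
    c • e = 0 := by
  obtain ⟨ι', π', h'⟩ := exists_comp_eq_smul_id_of_surjective ι π h Φ hΦ hker
  exact smul_ext_eq_zero_of_linearMap_comp_eq_smul_id ι' π' h' N hi e

/-- **Birational stable-annihilation transfer, abstract form.** Let `B → C` be commutative rings,
`Y₀ —ι₀→ P₀ —π₀→ Y₀` `B`-linear with `P₀` projective and `π₀ ∘ ι₀ = c • id`, and let `Y` be a
`C`-module receiving a surjective `C`-linear map `Φ : C ⊗[B] Y₀ → Y` whose kernel is killed by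
`ι₀.baseChange C : C ⊗[B] Y₀ → C ⊗[B] P₀` (e.g. `Y = (C ⊗[B] Y₀) ⧸ T` with `T` torsion and
`C ⊗[B] P₀` torsion-free). Then `(algebraMap B C c) • Extⁱ_C(Y, N) = 0` for every `C`-module `N` and
every `i ≥ 1`: by base change (`baseChange_comp_baseChange_eq_smul_id`) and descent
(`smul_ext_eq_zero_of_surjective`), `algebraMap B C c • id_Y` factors through the projective
`C`-module `C ⊗[B] P₀`. [folklore] -/
theorem smul_ext_eq_zero_of_baseChange {B C : Type u} [CommRing B] [CommRing C] [Algebra B C]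
    {Y₀ P₀ : Type u} [AddCommGroup Y₀] [Module B Y₀] [AddCommGroup P₀] [Module B P₀]
    [Module.Projective B P₀] (ι₀ : Y₀ →ₗ[B] P₀) (π₀ : P₀ →ₗ[B] Y₀) {c : B}
    (h : π₀ ∘ₗ ι₀ = c • LinearMap.id) {Y : Type u} [AddCommGroup Y] [Module C Y]
    (Φ : C ⊗[B] Y₀ →ₗ[C] Y) (hΦ : Function.Surjective Φ)
    (hker : LinearMap.ker Φ ≤ LinearMap.ker (ι₀.baseChange C))
    (N : ModuleCat.{u} C) {i : ℕ} (hi : 1 ≤ i) (e : Ext.{u} (ModuleCat.of C Y) N i) :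
    algebraMap B C c • e = 0 :=
  smul_ext_eq_zero_of_surjective (ι₀.baseChange C) (π₀.baseChange C)
    (baseChange_comp_baseChange_eq_smul_id ι₀ π₀ h) Φ hΦ hker N hi e

/-- **Birational stable-annihilation transfer, torsion-quotient form.** Let `B → C` be
commutative rings, `Y₀ —ι₀→ P₀ —π₀→ Y₀` `B`-linear with `P₀` projective and `π₀ ∘ ι₀ = c • id`,
and `T` a `C`-submodule of `C ⊗[B] Y₀` killed by `ι₀.baseChange C` (e.g. the torsion submodule,
when `C ⊗[B] P₀` is torsion-free). Then `(algebraMap B C c) • Extⁱ_C((C ⊗[B] Y₀) ⧸ T, N) = 0` for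
every `C`-module `N` and every `i ≥ 1` (`smul_ext_eq_zero_of_baseChange` for `Φ = T.mkQ`).
[folklore] -/
theorem smul_ext_quotient_eq_zero_of_baseChange {B C : Type u} [CommRing B] [CommRing C]
    [Algebra B C] {Y₀ P₀ : Type u} [AddCommGroup Y₀] [Module B Y₀] [AddCommGroup P₀]
    [Module B P₀] [Module.Projective B P₀] (ι₀ : Y₀ →ₗ[B] P₀) (π₀ : P₀ →ₗ[B] Y₀) {c : B}
    (h : π₀ ∘ₗ ι₀ = c • LinearMap.id) (T : Submodule C (C ⊗[B] Y₀))
    (hT : T ≤ LinearMap.ker (ι₀.baseChange C)) (N : ModuleCat.{u} C) {i : ℕ} (hi : 1 ≤ i)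
    (e : Ext.{u} (ModuleCat.of C ((C ⊗[B] Y₀) ⧸ T)) N i) : algebraMap B C c • e = 0 :=
  smul_ext_eq_zero_of_baseChange ι₀ π₀ h T.mkQ (Submodule.mkQ_surjective T)
    (by rwa [Submodule.ker_mkQ]) N hi e

/-! ## (4) The birational instance -/

/-- **Clearing denominators in `C ⊗[B] Y₀`.** Let `B → C` be birational in the weak sense that
every `s : C` satisfies `b · s = r · 1` for some non-zero-divisor `b ∈ B⁰` and some `r : B`. Then
every element `z` of `C ⊗[B] Y₀` (`Y₀` any `B`-module) has `b • z = 1 ⊗ y` for some `b ∈ B⁰` and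
some `y : Y₀` (induction on `z`: for `s ⊗ y` with `b s = r` one gets
`b • (s ⊗ y) = r ⊗ y = 1 ⊗ r y`, and two such identities combine over the product of the
denominators). [folklore] -/
theorem exists_nonZeroDivisors_smul_eq_one_tmul {B C : Type*} [CommRing B] [CommRing C]
    [Algebra B C] {Y₀ : Type*} [AddCommGroup Y₀] [Module B Y₀] (z : C ⊗[B] Y₀)
    (hbir : ∀ s : C, ∃ b : B, b ∈ B⁰ ∧ ∃ r : B, algebraMap B C b * s = algebraMap B C r) :
    ∃ b : B, b ∈ B⁰ ∧ ∃ y : Y₀, b • z = 1 ⊗ₜ y := by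
  induction z using TensorProduct.induction_on with
  | zero => exact ⟨1, one_mem _, 0, by rw [smul_zero, tmul_zero]⟩
  | tmul s y =>
    obtain ⟨b, hb, r, hr⟩ := hbir s
    refine ⟨b, hb, r • y, ?_⟩
    rw [smul_tmul', Algebra.smul_def, hr, Algebra.algebraMap_eq_smul_one, smul_tmul]
  | add z₁ z₂ h₁ h₂ =>
    obtain ⟨b₁, hb₁, y₁, h₁⟩ := h₁
    obtain ⟨b₂, hb₂, y₂, h₂⟩ := h₂
    refine ⟨b₁ * b₂, mul_mem hb₁ hb₂, b₂ • y₁ + b₁ • y₂, ?_⟩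
    rw [tmul_add, tmul_smul, tmul_smul, ← h₁, ← h₂, smul_add, smul_smul, smul_smul,
      mul_comm b₂ b₁]

/-- **The kernel of the multiplication map is torsion.** Let `B → C` be birational (every `s : C`
has `b · s = r` with `b ∈ B⁰`, `r : B`), `Y` a `C`-module (a `B`-module through `C`) and
`φ : Y₀ → Y` an injective `B`-linear map. If `z : C ⊗[B] Y₀` is killed by the multiplication map
`Φ = φ.liftBaseChange C : s ⊗ y ↦ s • φ y`, then `b • z = 0` for some non-zero-divisor `b ∈ B⁰`:
write `b • z = 1 ⊗ y` (`exists_nonZeroDivisors_smul_eq_one_tmul`); then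
`φ y = Φ (b • z) = b • Φ z = 0`, so `y = 0`. [folklore] -/
theorem exists_nonZeroDivisors_smul_eq_zero_of_liftBaseChange_eq_zero {B C : Type*} [CommRing B]
    [CommRing C] [Algebra B C] {Y₀ : Type*} [AddCommGroup Y₀] [Module B Y₀] {Y : Type*}
    [AddCommGroup Y] [Module C Y] [Module B Y] [IsScalarTower B C Y] (φ : Y₀ →ₗ[B] Y)
    (hφ : Function.Injective φ)
    (hbir : ∀ s : C, ∃ b : B, b ∈ B⁰ ∧ ∃ r : B, algebraMap B C b * s = algebraMap B C r)
    {z : C ⊗[B] Y₀} (hz : φ.liftBaseChange C z = 0) : ∃ b : B, b ∈ B⁰ ∧ b • z = 0 := by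
  obtain ⟨b, hb, y, hy⟩ := exists_nonZeroDivisors_smul_eq_one_tmul z hbir
  have h1 : φ y = 0 := by
    have := congrArg (φ.liftBaseChange C) hy
    rw [LinearMap.map_smul_of_tower, hz, smul_zero, LinearMap.liftBaseChange_tmul,
      one_smul] at this
    exact this.symm
  have h2 : y = 0 := hφ (by rw [h1, map_zero])
  exact ⟨b, hb, by rw [hy, h2, tmul_zero]⟩

/-- **The kernel of the multiplication map is killed by every map to a torsion-free module.** Let
`B → C` be birational (every `s : C` has `b · s = r` with `b ∈ B⁰`, `r : B`), `φ : Y₀ → Y` an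
injective `B`-linear map from a `B`-module to a `C`-module, and `P` a `C`-module which is
torsion-free as a `B`-module. Then `ker (φ.liftBaseChange C) ≤ ker g` for every `C`-linear
`g : C ⊗[B] Y₀ → P`: the kernel is `B⁰`-torsion
(`exists_nonZeroDivisors_smul_eq_zero_of_liftBaseChange_eq_zero`) and `B⁰` acts injectively on
`P`. [folklore] -/
theorem ker_liftBaseChange_le_ker {B C : Type*} [CommRing B] [CommRing C] [Algebra B C]
    {Y₀ : Type*} [AddCommGroup Y₀] [Module B Y₀] {Y : Type*} [AddCommGroup Y] [Module C Y]
    [Module B Y] [IsScalarTower B C Y] (φ : Y₀ →ₗ[B] Y) (hφ : Function.Injective φ)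
    (hbir : ∀ s : C, ∃ b : B, b ∈ B⁰ ∧ ∃ r : B, algebraMap B C b * s = algebraMap B C r)
    {P : Type*} [AddCommGroup P] [Module C P] [Module B P] [IsScalarTower B C P]
    [Module.IsTorsionFree B P] (g : C ⊗[B] Y₀ →ₗ[C] P) :
    LinearMap.ker (φ.liftBaseChange C) ≤ LinearMap.ker g := by
  intro z hz
  obtain ⟨b, hb, hbz⟩ :=
    exists_nonZeroDivisors_smul_eq_zero_of_liftBaseChange_eq_zero φ hφ hbir hz
  have hg : b • g z = 0 := by rw [← LinearMap.map_smul_of_tower, hbz, map_zero]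
  exact (isRegular_iff_mem_nonZeroDivisors.mpr hb).smul_eq_zero_iff_right.mp hg

/-- **The multiplication map is onto the span.** For a `B`-linear map `φ : Y₀ → Y` into a
`C`-module whose image generates `Y` over `C`, the multiplication map
`φ.liftBaseChange C : C ⊗[B] Y₀ → Y`, `s ⊗ y ↦ s • φ y`, is surjective (its range is the `C`-span
of the range of `φ`, Mathlib's `LinearMap.range_liftBaseChange`). [folklore] -/
theorem liftBaseChange_surjective_of_span_eq_top {B C : Type*} [CommRing B] [CommRing C]
    [Algebra B C] {Y₀ : Type*} [AddCommGroup Y₀] [Module B Y₀] {Y : Type*} [AddCommGroup Y]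
    [Module C Y] [Module B Y] [IsScalarTower B C Y] (φ : Y₀ →ₗ[B] Y)
    (hspan : Submodule.span C (Set.range φ) = ⊤) :
    Function.Surjective (φ.liftBaseChange C) := by
  rw [← LinearMap.range_eq_top, LinearMap.range_liftBaseChange, LinearMap.coe_range, hspan]

/-- **Birational stable-annihilation transfer.** Let `B → C` be a birational map of commutative
rings — every `s : C` has `b · s = r · 1` for some non-zero-divisor `b ∈ B⁰` and some `r : B` —
with `C` torsion-free over `B` (e.g. `B ⊆ C ⊆ Frac B`: a finite birational extension, the
normalisation, an affine blow-up chart of a domain). Let `Y₀` be a `B`-module on which `c • id`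
(`c : B`) factors `B`-linearly through a projective `B`-module `P₀` (`π₀ ∘ ι₀ = c • id`), and let
`Y` be a `C`-module generated over `C` by the image of an injective `B`-linear map `φ : Y₀ → Y`
(`Y = C · φ(Y₀)`; no torsion-freeness of `Y` is required). Then
`(algebraMap B C c) • Extⁱ_C(Y, N) = 0` for every `C`-module `N` and every `i ≥ 1`. Proof: the
multiplication map `C ⊗[B] Y₀ → Y` is surjective with `B⁰`-torsion kernel, which
`ι₀.baseChange C` kills because `C ⊗[B] P₀` is torsion-free over `B`
(`isTorsionFree_baseChange`); conclude by `smul_ext_eq_zero_of_baseChange`. The hypothesis `hbir`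
is deliberately placed after `ι₀ π₀ h` (see the module docstring). [folklore] -/
theorem smul_ext_eq_zero_of_isBirational {B C : Type u} [CommRing B] [CommRing C] [Algebra B C]
    [Module.IsTorsionFree B C] {Y₀ P₀ : Type u} [AddCommGroup Y₀] [Module B Y₀]
    [AddCommGroup P₀] [Module B P₀] [Module.Projective B P₀] (ι₀ : Y₀ →ₗ[B] P₀)
    (π₀ : P₀ →ₗ[B] Y₀) {c : B} (h : π₀ ∘ₗ ι₀ = c • LinearMap.id)
    (hbir : ∀ s : C, ∃ b : B, b ∈ B⁰ ∧ ∃ r : B, algebraMap B C b * s = algebraMap B C r)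
    {Y : Type u} [AddCommGroup Y] [Module C Y] [Module B Y] [IsScalarTower B C Y]
    (φ : Y₀ →ₗ[B] Y) (hφ : Function.Injective φ)
    (hspan : Submodule.span C (Set.range φ) = ⊤)
    (N : ModuleCat.{u} C) {i : ℕ} (hi : 1 ≤ i) (e : Ext.{u} (ModuleCat.of C Y) N i) :
    algebraMap B C c • e = 0 :=
  haveI := isTorsionFree_baseChange B C P₀
  smul_ext_eq_zero_of_baseChange ι₀ π₀ h (φ.liftBaseChange C)
    (liftBaseChange_surjective_of_span_eq_top φ hspan)
    (ker_liftBaseChange_le_ker φ hφ hbir (ι₀.baseChange C)) N hi e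

/-! ### Subalgebras `B ≤ C` of a field with `C ⊆ Frac B` -/

section Subalgebra

open Literature.RingTheory.Localization

variable {k : Type*} {K : Type u} [CommRing k] [Field K] [Algebra k K] {B C : Subalgebra k K}

/-- For subalgebras `B`, `C` of a field `K` with an algebra structure `↥B → ↥C` compatible with
the inclusions into `K`, `↥C` is a torsion-free `↥B`-module (non-zero elements of `B` are units
of `K`). [folklore] -/
theorem Subalgebra.isTorsionFree_of_isScalarTower [Algebra B C] [IsScalarTower B C K] :
    Module.IsTorsionFree B C :=
  haveI : Module.IsTorsionFree B K := Subalgebra.isTorsionFree_left B K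
  Subtype.val_injective.moduleIsTorsionFree (Subtype.val : C → K) fun b s => by
    rw [Subalgebra.coe_smul_eq_mul, Subalgebra.smul_def, smul_eq_mul]

/-- **Birational stable-annihilation transfer for subalgebras of a field.** Let `B`, `C` be
subalgebras of a field `K` (over a base ring `k`) with an algebra structure `↥B → ↥C` compatible
with the inclusions into `K` (e.g. the inclusion of `B ≤ C`), and assume `C ⊆ Frac B` inside `K`:
`∀ s ∈ C, ∃ b ∈ B, b ≠ 0 ∧ b * s ∈ B`. Let `V` be a `K`-vector space, `Y₀ ⊆ V` a `↥B`-submodule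
and `Y = C · Y₀ ⊆ V` the `↥C`-submodule it spans. If `c • id_{Y₀}` (`c : B`) factors `↥B`-linearly
through a projective `↥B`-module (`π₀ ∘ ι₀ = c • id`), then `(algebraMap B C c) • Extⁱ_C(Y, N) = 0`
for every `↥C`-module `N` and every `i ≥ 1` (`smul_ext_eq_zero_of_isBirational` applied to the
inclusion `Y₀ → Y`). [folklore] -/
theorem Subalgebra.smul_ext_eq_zero_of_span_eq [Algebra B C] [IsScalarTower B C K]
    (hfrac : ∀ s ∈ C, ∃ b ∈ B, b ≠ 0 ∧ b * s ∈ B)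
    {V : Type u} [AddCommGroup V] [Module K V] {Y₀ : Submodule B V} {Y : Submodule C V}
    (hY : Submodule.span C (Y₀ : Set V) = Y)
    {P₀ : Type u} [AddCommGroup P₀] [Module B P₀] [Module.Projective B P₀]
    (ι₀ : Y₀ →ₗ[B] P₀) (π₀ : P₀ →ₗ[B] Y₀) {c : B} (h : π₀ ∘ₗ ι₀ = c • LinearMap.id)
    (N : ModuleCat.{u} C) {i : ℕ} (hi : 1 ≤ i) (e : Ext.{u} (ModuleCat.of C Y) N i) :
    algebraMap B C c • e = 0 := by
  haveI := Subalgebra.isScalarTower_module (B := B) (C := C) V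
  haveI : Module.IsTorsionFree B C := Subalgebra.isTorsionFree_of_isScalarTower
  have hle : (Y₀ : Set V) ⊆ Y := hY ▸ Submodule.subset_span
  let φ : Y₀ →ₗ[B] Y :=
    { toFun := fun y => ⟨y, hle y.2⟩
      map_add' := fun _ _ => rfl
      map_smul' := fun _ _ => rfl }
  have hφ : Function.Injective φ := fun y₁ y₂ h12 =>
    Subtype.ext (congrArg (Subtype.val : Y → V) h12)
  have himg : (Subtype.val : Y → V) '' Set.range φ = (Y₀ : Set V) := by
    ext v
    constructor
    · rintro ⟨_, ⟨y, rfl⟩, rfl⟩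
      exact y.2
    · intro hv
      exact ⟨⟨v, hle hv⟩, ⟨⟨v, hv⟩, rfl⟩, rfl⟩
  have hspan : Submodule.span C (Set.range φ) = ⊤ := by
    apply Submodule.map_injective_of_injective Y.injective_subtype
    rw [Submodule.map_span, Submodule.map_top, Submodule.range_subtype, Submodule.coe_subtype,
      himg, hY]
  exact smul_ext_eq_zero_of_isBirational ι₀ π₀ h
    (Subalgebra.exists_mem_nonZeroDivisors_mul_eq hfrac) φ hφ hspan N hi e

/-- **Birational stable-annihilation transfer for a bare inclusion `B ≤ C` of subalgebras of a
field** (the instance plumbing made explicit; `↥B → ↥C` is `Subalgebra.inclusion`). For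
subalgebras `B ≤ C` of a field `K` with `C ⊆ Frac B` inside `K`
(`∀ s ∈ C, ∃ b ∈ B, b ≠ 0 ∧ b * s ∈ B`), a `↥B`-submodule `Y₀` of a `K`-vector space `V` spanning
the `↥C`-submodule `Y`, and `c : B` such that `c • id_{Y₀}` factors `↥B`-linearly through a
projective `↥B`-module, the element `c ∈ C` kills `Extⁱ_C(Y, N)` for every `↥C`-module `N` and
every `i ≥ 1`. [folklore] -/
theorem Subalgebra.smul_ext_eq_zero_of_le_of_span_eq (hBC : B ≤ C)
    (hfrac : ∀ s ∈ C, ∃ b ∈ B, b ≠ 0 ∧ b * s ∈ B)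
    {V : Type u} [AddCommGroup V] [Module K V] {Y₀ : Submodule B V} {Y : Submodule C V}
    (hY : Submodule.span C (Y₀ : Set V) = Y)
    {P₀ : Type u} [AddCommGroup P₀] [Module B P₀] [Module.Projective B P₀]
    (ι₀ : Y₀ →ₗ[B] P₀) (π₀ : P₀ →ₗ[B] Y₀) {c : B} (h : π₀ ∘ₗ ι₀ = c • LinearMap.id)
    (N : ModuleCat.{u} C) {i : ℕ} (hi : 1 ≤ i) (e : Ext.{u} (ModuleCat.of C Y) N i) :
    Subalgebra.inclusion hBC c • e = 0 :=
  letI := (Subalgebra.inclusion hBC).toRingHom.toAlgebra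
  haveI := Subalgebra.isScalarTower_inclusion hBC
  Subalgebra.smul_ext_eq_zero_of_span_eq hfrac hY ι₀ π₀ h N hi e

end Subalgebra

end Literature.RingTheory.CohomologyAnnihilator
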